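import Summits.RiemannHypothesis.RiemannHypothesis.Theorems.WeilFormatCPolyWindowMixedBox
import Literature.Analysis.ValidatedNumerics.DigammaKernelValues
import HarnessLib

/-!
# Format C, design C∞ — (E) side IV: glue for the door generator (γ, `1/√(2a)`, claimed entry / mixed tables)

Route context: Fourier–Galerkin / Schur-complement certificates of Weil positivity on a window ("format C", design C∞;
`run/shared/lean/pub/rh-explicit/rh-explicit-weil-10/KERNEL-LEVER.md` §17; supporting stmt-RiemannHypothesis-0098; seats rh-explicit-weil-2 /
weil-10).  The last (E)-side conveniences so that a generated rung file states its C∞ data as literal tables and discharges them by `decide`: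
* `gammaBox` ∋ `γ = −Re ψ(1)` (`MC.digammaBox` with the proved Bernoulli table, `Complex.digamma_one`);
* `invSqrtBox` ∋ `1/√(n/d) = e^{(log d − log n)/2}` (for `Rs ∋ 1/√(2a)`, `2a = n/d`);
* `checkEntryTable` / `mem_of_checkEntryTable` — a claimed table `etab[j][k]`, `j,k ≤ P`, of the profile × profile entries `E_{jk}`;
* `mixedInputs`, `checkMixedTable` / `mem_of_checkMixedTable` — a claimed table `mtab[m][j]` (`1 ≤ m ≤ N`, `j ≤ P`) of the mixed entries
  `W_a(1x^j, χ_m)`, the per-mode records coming from a validated light table (`Encl.TabValid`).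
Interval plumbing; standard axioms; no RH claim.
-/

set_option autoImplicit false
-- `Summit.RiemannHypothesis.RiemannHypothesis.…` is the layout-mandated namespace (summit = problem name).
set_option linter.dupNamespace false

open Complex Filter Set MeasureTheory Finset
open scoped Real Topology

namespace Summit.RiemannHypothesis.RiemannHypothesis.Theorems.WeilFormatC

open Literature.NumberTheory.LFunctions Literature.Analysis.SpecialFunctions
open Literature.Analysis.ValidatedNumerics Literature.Analysis.ValidatedNumerics.NumericsMP
open Literature.NumberTheory.LFunctions.Yoshida1992 (PrimeLen PrimeData freq)
open Literature.NumberTheory.LFunctions.Yoshida1992.Encl (Consts ConstsValid IdxRec OffValid DiagValid IdxValid TabValid tget within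
  mem_of_within withinC memC_of_withinC)

namespace WinGlue

open WinConst (ratBox mem_ratBox)
open WinEntry (entryBox entryVal mem_entryBox wtab)
open WinMixed (Inputs InputsValid mixedBox mem_mixedBox invBox mem_invBox jcBox mem_jcBox)

/-! ## `γ` and `1/√(n/d)` -/

/-- `γ = −Re ψ(1)` by the interval digamma (shifted Stirling series, proved Bernoulli table). -/
def gammaBox (S K J : ℕ) (P : MI) : Option MI :=
  match MC.digammaBox S K J P MC.bernoulliTable (MC.ofInt S 1) with
  | some Y => some Y.re.neg
  | none => none

/-- `gammaBox ∋ γ`. -/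
theorem mem_gammaBox {S : ℕ} (hS : 0 < S) {K J : ℕ} {P G : MI} (hP : MI.mem S Real.pi P) (h : gammaBox S K J P = some G) :
    MI.mem S Real.eulerMascheroniConstant G := by
  unfold gammaBox at h
  split at h
  · rename_i Y hY
    simp only [Option.some.injEq] at h
    subst h
    have h1 : MC.mem S (1 : ℂ) (MC.ofInt S 1) := by simpa using MC.mem_ofInt S 1
    have hψ := MC.mem_digammaBox_table hS hP hY h1
    have hre : (Complex.digamma 1).re = -Real.eulerMascheroniConstant := by
      rw [Complex.digamma_one]; simp
    have := MI.mem_neg hψ.1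
    rw [hre, neg_neg] at this
    exact this
  · simp at h

/-- `1/√(n/d) = e^{(log d − log n)/2}` by interval logarithms and the interval exponential. -/
def invSqrtBox (S K kred : ℕ) (n d : ℕ) : Option MI :=
  match MI.logNat2 S K n, MI.logNat2 S K d with
  | some Ln, some Ld => MI.exp S K kred ((Ld.sub Ln).divNat 2)
  | _, _ => none

/-- `invSqrtBox ∋ 1/√(n/d)` (`n, d ≥ 1`). -/
theorem mem_invSqrtBox {S : ℕ} (hS : 0 < S) {K kred n d : ℕ} (hn : 0 < n) (hd : 0 < d) {Y : MI}
    (h : invSqrtBox S K kred n d = some Y) : MI.mem S (1 / Real.sqrt ((n : ℝ) / d)) Y := by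
  unfold invSqrtBox at h
  split at h
  · rename_i Ln Ld hLn hLd
    have hx : MI.mem S ((Real.log d - Real.log n) / 2) ((Ld.sub Ln).divNat 2) :=
      MI.mem_divNat (MI.mem_sub (MI.mem_logNat2 hS hLd) (MI.mem_logNat2 hS hLn)) (n := 2) (by norm_num)
    have he := MI.mem_exp hS h hx
    convert he using 1
    have hn' : (0 : ℝ) < n := by exact_mod_cast hn
    have hd' : (0 : ℝ) < d := by exact_mod_cast hd
    have hq : (0 : ℝ) < (n : ℝ) / d := by positivity
    rw [Real.sqrt_eq_rpow, Real.rpow_def_of_pos hq, one_div, ← Real.exp_neg, Real.log_div hn'.ne' hd'.ne']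
    congr 1
    ring
  · simp at h

/-! ## Claimed tables of profile × profile entries -/

section EntryTable

variable {S : ℕ} {a : ℚ} {ks : List PrimeLen} {C : Consts} {Ep Em T Mk : MI} {tab : List MI} {Q P : ℕ}

/-- The checker of a claimed table `etab[j][k] ∋ E_{jk}`, `j, k ≤ P`: recompute every entry box and test containment. -/
def checkEntryTable (S : ℕ) (Ep Em : MI) (C : Consts) (nks : ℕ) (tab : List MI) (T Mk : MI) (a : ℚ) (P : ℕ)
    (etab : List (List MI)) : Bool :=
  (List.range (P + 1)).all fun j ↦ (List.range (P + 1)).all fun k ↦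
    within (entryBox S Ep Em C nks tab T Mk a j k) ((etab.getD j []).getD k default)

/-- **Soundness of `checkEntryTable`**: with the hypotheses of `mem_entryBox` (table of window constants valid up to `Q ≥ 2P+1`),
every claimed entry contains `E_{jk} = W_a(1x^j, 1x^k)`. -/
theorem mem_of_checkEntryTable (hS : 0 < S) (ha : 0 < a) (hks : PrimeData (a : ℝ) ks) (hC : ConstsValid S (a : ℝ) ks C)
    (hEp : MI.mem S (Real.exp ((a : ℝ) / 2)) Ep) (hEm : MI.mem S (Real.exp (-((a : ℝ) / 2))) Em)
    (hW : ∀ q, 1 ≤ q → q ≤ Q → MI.mem S (∫ t in Ioc 0 (2 * (a : ℝ)), weilArchDensity t * t ^ q) (wtab tab q))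
    (hT : MI.mem S (∫ t in Ioi (2 * (a : ℝ)), weilArchDensity t) T) (hMk : MI.mem S (weilMarkovConstant (a : ℝ)) Mk)
    (hPQ : 2 * P + 1 ≤ Q) {etab : List (List MI)} (h : checkEntryTable S Ep Em C ks.length tab T Mk a P etab = true)
    {j k : ℕ} (hj : j ≤ P) (hk : k ≤ P) :
    MI.mem S (entryVal (a : ℝ) j k) ((etab.getD j []).getD k default) := by
  rw [checkEntryTable, List.all_eq_true] at h
  have h1 := h j (List.mem_range.2 (by omega))
  rw [List.all_eq_true] at h1
  have h2 := h1 k (List.mem_range.2 (by omega))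
  exact mem_of_within h2 (mem_entryBox hS ha hks hC hEp hEm hW hT hMk (by omega))

end EntryTable

/-! ## Claimed tables of mixed entries -/

section MixedTable

variable {S : ℕ} {a : ℚ} {ks : List PrimeLen} {C : Consts} {Ep Em Rs Psi4 T Mk : MI} {tab : List MI} {Q P N : ℕ}
  {rtab : List IdxRec}

/-- The inputs record of the mode whose light-table record is `R` (`none` if `1/ω` or `J_c` cannot be boxed). -/
def mixedInputs (S : ℕ) (C : Consts) (R : IdxRec) (Ep Em Rs Psi4 : MI) (tab : List MI) (T Mk : MI) : Option Inputs :=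
  match invBox S R.om, jcBox S C R Psi4 with
  | some U, some Jc => some ⟨Ep, Em, Rs, Psi4, U, Jc, tab, T, Mk⟩
  | _, _ => none

/-- Validity of `mixedInputs` from the validity of its ingredients. -/
theorem mixedInputs_valid (hS : 0 < S) (ha : 0 < a) (hC : ConstsValid S (a : ℝ) ks C) {m : ℕ} {R : IdxRec}
    (hR : IdxValid S (a : ℝ) ks m R) (hEp : MI.mem S (Real.exp ((a : ℝ) / 2)) Ep)
    (hEm : MI.mem S (Real.exp (-((a : ℝ) / 2))) Em) (hRs : MI.mem S (1 / Real.sqrt (2 * (a : ℝ))) Rs)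
    (hPsi : MI.mem S (reDigammaQuarter 0) Psi4)
    (hW : ∀ q, 1 ≤ q → q ≤ Q → MI.mem S (∫ t in Ioc 0 (2 * (a : ℝ)), weilArchDensity t * t ^ q) (wtab tab q))
    (hT : MI.mem S (∫ t in Ioi (2 * (a : ℝ)), weilArchDensity t) T) (hMk : MI.mem S (weilMarkovConstant (a : ℝ)) Mk)
    {X : Inputs} (hX : mixedInputs S C R Ep Em Rs Psi4 tab T Mk = some X) : InputsValid S a (m : ℤ) Q X := by
  unfold mixedInputs at hX
  split at hX
  · rename_i U Jc hU hJc
    simp only [Option.some.injEq] at hX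
    subst hX
    have hω := hR.1.om
    simp only [freq] at hω
    exact { Ep := hEp, Em := hEm, Rs := hRs, Psi4 := hPsi, U := mem_invBox hS hω hU,
            Jc := mem_jcBox hS ha hC hR.1 hR.2 hPsi hJc, tab := hW, T := hT, Mk := hMk }
  · simp at hX

/-- The checker of a claimed table `mtab[m][j] ∋ W_a(1x^j, χ_m)`, `1 ≤ m ≤ N`, `j ≤ P` (row `0` unused). -/
def checkMixedTable (S : ℕ) (a : ℚ) (C : Consts) (rtab : List IdxRec) (Ep Em Rs Psi4 : MI) (tab : List MI) (T Mk : MI)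
    (N P : ℕ) (mtab : List (List MC)) : Bool :=
  (List.range N).all fun i ↦
    match mixedInputs S C (tget rtab (i + 1)) Ep Em Rs Psi4 tab T Mk with
    | some X => (List.range (P + 1)).all fun j ↦
        withinC (mixedBox S a ((i + 1 : ℕ) : ℤ) j C (tget rtab (i + 1)) X) ((mtab.getD (i + 1) []).getD j default)
    | none => false

/-- **Soundness of `checkMixedTable`**: with a validated light table `rtab` (`TabValid` up to `N+1`) and valid scalar inputs,
every claimed entry contains `W_a(1x^j, χ_m)` (`1 ≤ m ≤ N`, `j ≤ P ≤ Q`). -/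
theorem mem_of_checkMixedTable (hS : 0 < S) (ha : 0 < a) (hks : PrimeData (a : ℝ) ks) (hC : ConstsValid S (a : ℝ) ks C)
    (hrt : TabValid S (a : ℝ) ks (N + 1) rtab) (hEp : MI.mem S (Real.exp ((a : ℝ) / 2)) Ep)
    (hEm : MI.mem S (Real.exp (-((a : ℝ) / 2))) Em) (hRs : MI.mem S (1 / Real.sqrt (2 * (a : ℝ))) Rs)
    (hPsi : MI.mem S (reDigammaQuarter 0) Psi4)
    (hW : ∀ q, 1 ≤ q → q ≤ Q → MI.mem S (∫ t in Ioc 0 (2 * (a : ℝ)), weilArchDensity t * t ^ q) (wtab tab q))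
    (hT : MI.mem S (∫ t in Ioi (2 * (a : ℝ)), weilArchDensity t) T) (hMk : MI.mem S (weilMarkovConstant (a : ℝ)) Mk)
    (hPQ : P ≤ Q) {mtab : List (List MC)} (h : checkMixedTable S a C rtab Ep Em Rs Psi4 tab T Mk N P mtab = true)
    {m : ℕ} (hm1 : 1 ≤ m) (hmN : m ≤ N) {j : ℕ} (hj : j ≤ P) :
    MC.mem S (weilWindowSesq (a : ℝ) ((Icc (-(a : ℝ)) (a : ℝ)).indicator fun x : ℝ ↦ ((x : ℂ)) ^ j)
        (Yoshida1992.chi (a : ℝ) (m : ℤ))) ((mtab.getD m []).getD j default) := by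
  rw [checkMixedTable, List.all_eq_true] at h
  obtain ⟨i, rfl⟩ : ∃ i, m = i + 1 := ⟨m - 1, by omega⟩
  have hi := h i (List.mem_range.2 (by omega))
  split at hi
  · rename_i X hX
    rw [List.all_eq_true] at hi
    have hij := hi j (List.mem_range.2 (by omega))
    have hR : IdxValid S (a : ℝ) ks (i + 1) (tget rtab (i + 1)) := hrt (i + 1) (by omega)
    have hXv := mixedInputs_valid (Q := Q) hS ha hC hR hEp hEm hRs hPsi hW hT hMk hX
    have hm0 : ((i + 1 : ℕ) : ℤ) ≠ 0 := by omega
    exact memC_of_withinC hij (mem_mixedBox hS ha hm0 hks hC hR.1 hXv (le_trans hj hPQ))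
  · simp at hi

end MixedTable

end WinGlue

end Summit.RiemannHypothesis.RiemannHypothesis.Theorems.WeilFormatC
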